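import Literature.Analysis.FluidPDE.RusinSverakRhoMaxPureLe
import Literature.Analysis.FluidPDE.KatoLocalBoundedProofs
import Literature.Analysis.FluidPDE.OseenMildUniqueness
import Literature.Analysis.FluidPDE.OseenDuhamelHomSobolev
import HarnessLib

/-!
# `ρ_max^pure ≤ ρ_max`: discharge of `bounded_mild_fujitaKato_persistence` and of
# `rusinSverakRhoMaxPure_le` (the Kato and the Fujita–Kato solutions coincide)

Analysis/FluidPDE proof file (no definitions, no named facts). It **discharges** the analytic core
`Literature.Analysis.FluidPDE.bounded_mild_fujitaKato_persistence` of `RusinSverakRhoMaxPureLe.lean`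
— an unforced mild solution `v` on `[0, T)` in `C([0,T); L³) ∩ L^∞((0,T) × ℝ³)` whose datum lies in
`Ḣ^{1/2} ∩ L²` stays in `C([0,T); Ḣ^{1/2} ∩ L²) ∩ C([0,T); L²)` — and with it (through the
reductions already proved there) `kato_fujitaKato_persistence` and **ns.S14**
`Literature.Analysis.FluidPDE.rusinSverakRhoMaxPure_le` (`MildSolutions.lean`):
`rusinSverakRhoMaxPure ν ≤ rusinSverakRhoMax ν` for `ν > 0`.

## The argument (Lemarié-Rieusset 2016, Thm. 15.2 / proof of Thm. 15.1 (A), p. 565: the Kato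
solution `u ∈ C([0,T*), L³)` has `∫₀ᵗ W_{ν(t-s)} * ℙ∇·(u⊗u) ds ∈ C([0,S], L²)`; Rusin–Šverák 2011,
§3: "the mild solutions have the same regularity as `U = S(t)u₀`")

The proof never derives a Duhamel formula for the *given* `v`; it identifies `v`, window by
window, with solutions that satisfy one by construction, and transports regularity along a.e.
equality of slices (uniqueness in `C_t L³`, the tree's `kato_unique_holds`):

1. **Near `t = 0`** (`exists_fujitaKato_class_near_zero_Ico`): the local Fujita–Kato solution
   (`fujita_kato_local_holds`) lies in `C_t L³` and agrees with `v` a.e. (`kato_unique_holds`).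
2. **Windows of fixed length** (`exists_kato_window_L2H`, `§ Window`): Oseen's scheme for bounded
   data (`exists_oseen_fixedPoint_bounded`, Lemarié-Rieusset 2016, Thm. 5.1 and proof of
   Thm. 9.11, pp. 256–257: "convergence of `γ_n` in `L^∞L²` as well") run twice, with the `L³` and
   with the `L²` bound carried along, gives one fixed point (`oseenMild_bounded_unique`), a Kato
   solution on `[0, c₀ν/A²)` which is also in `C_t L²` (`continuousInLpOn_oseen_fixedPoint`); away
   from the window start its slices are in `Ḣ^{3/4} ∩ L²` with a uniform bound, by the heat
   smoothing `‖e^{νtΔ}a‖_{Ḣ^s} ≤ (8π²νt)^{-s/2}‖a‖₂` (`HomSobolevInterpolation.lean`) and the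
   Duhamel smoothing `‖B^ν_0(u,u)(t)‖_{Ḣ^s} ≤ C ν^{-(1+s)/2} t^{(1-s)/2} M L`
   (`OseenDuhamelHomSobolev.lean`).
3. **Induction over the windows** `[sₖ, sₖ + T_w)`, `sₖ = T₁/2 + k T_w/2` (`§ Core`): the datum
   `v(sₖ)` is in `L² ∩ L³ ∩ L^∞`, the window solution agrees with `v(· + sₖ)` (restart
   `mild_L3_restart_holds`, uniqueness), so `v ∈ C_t L²` on the window and `v(t) ∈ Ḣ^{3/4}`
   uniformly on its upper part; this feeds the next window.
4. **`Ḣ^{1/2}`-continuity by interpolation** (`§ Criterion`):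
   `‖v(t) - v(t₀)‖_{Ḣ^{1/2}} ≤ ‖v(t) - v(t₀)‖₂^{1/3} (2K)^{2/3} → 0` (BCD 2011, Prop. 1.32;
   `Function.eHomSobolevSeminorm_le_eLpNorm_rpow_mul_rpow`) — no `Ḣ^{1/2}` estimate of the
   nonlinearity and no strong continuity of the heat semigroup in `Ḣ^{1/2}` is needed.

## Mathlib / tree search

Everything used is listed in the headers of the four imports; in addition `Nat.floor_le`,
`Nat.lt_floor_add_one`, `nhdsWithin_inter_of_mem`, `Ioo_mem_nhds`. No statement linking
`HasGlobalKatoSolution` and `HasGlobalFujitaKatoSolution` was proved before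
(`lean search 'kato_fujitaKato|bounded_mild_fujitaKato'`: only the named facts and reductions of
`RusinSverakRhoMaxPureLe.lean`).

## References

* P. G. Lemarié-Rieusset, *The Navier–Stokes Problem in the 21st Century*, CRC Press 2016,
  doi:10.1201/b19556: Thm. 5.1 (PDF pp. 103–105), Thm. 7.4 (proof, p. 151), Thm. 9.11 (proof,
  pp. 256–257), Thm. 15.1 (A) (proof, p. 565), Thm. 15.2. [LemarieRieusset2016]
* W. Rusin, V. Šverák, *Minimal initial data for potential Navier–Stokes singularities*,
  J. Funct. Anal. 260 (2011) 879–891 = arXiv:0911.0500, §1, §3. [RusinSverak2011]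
* H. Bahouri, J.-Y. Chemin, R. Danchin, *Fourier Analysis and Nonlinear PDE*, Springer 2011,
  Prop. 1.32. [BahouriCheminDanchin2011]
-/

noncomputable section

open MeasureTheory Set Function Filter
open _root_.Topology
open scoped ENNReal NNReal FourierTransform RealInnerProductSpace

namespace Literature.Analysis.FluidPDE

open FunctionSpaces.EuclideanSpace (complexify)
open FunctionSpaces (MemHomSobolev)

/-! ### The window: a Kato solution from bounded `L³ ∩ L²` data, in `C_t L²`, smoothed in `Ḣ^{3/4}` -/

section Window

/-- **Local Kato solutions from bounded `L³ ∩ L²` data carry the `L²` norm and gain `Ḣ^{3/4}`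
regularity** (Lemarié-Rieusset 2016, Thm. 5.1 with the proof of Thm. 9.11, PDF pp. 256–257:
Oseen's Picard iterates from a bounded datum converge in `L^∞L^∞` "and … in `L^∞L²` as well";
proof of Thm. 7.4, p. 151, for the `Ḣ^s` smoothing of both terms of the integral equation). There
is an absolute `c₀ > 0` such that for `ν > 0`, `A > 0` and a weakly divergence-free
`a ∈ L³ ∩ L²(ℝ³)` with `‖a‖_∞ ≤ A`, there is a Kato solution `w` on `[0, T_A)`, `T_A = c₀ν/A²`,
with datum `a` (`IsKatoSolutionOn`), bounded by `2A`, which moreover lies in `C([0,T_A); L²)`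
and whose slices on every `[δ, T_A)`, `δ > 0`, lie in `Ḣ^{3/4} ∩ L²` with a common bound on
`‖w(t)‖_{Ḣ^{3/4}}`. Proof: the Oseen fixed points with the `L³` and with the `L²` bound carried
along (`exists_oseen_fixedPoint_bounded`) coincide (`oseenMild_bounded_unique`); the rest is the
assembly of `kato_local_bounded_holds`, `continuousInLpOn_oseen_fixedPoint` for `p = 2`, and the
smoothing bounds `Function.eHomSobolevSeminorm_heatExtension_le_eLpNorm`,
`exists_eHomSobolevSeminorm_oseenDuhamel_le`. [cite: LemarieRieusset2016, Thm. 5.1 (pp. 103–105),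
Thm. 9.11 (proof, pp. 256–257), Thm. 7.4 (proof, p. 151)] -/
theorem exists_kato_window_L2H :
    ∃ c₀ : ℝ, 0 < c₀ ∧ ∀ {ν A : ℝ} (_hν : 0 < ν) (_hA : 0 < A) {a : (EuclideanSpace ℝ (Fin 3)) → (EuclideanSpace ℝ (Fin 3))}
      (_ha3 : MemLp a 3 volume) (_ha2 : MemLp a 2 volume) (_hdiv : IsWeaklyDivFree a)
      (_hbd : eLpNorm a ∞ volume ≤ ENNReal.ofReal A),
      ∃ w : ℝ → (EuclideanSpace ℝ (Fin 3)) → (EuclideanSpace ℝ (Fin 3)), IsKatoSolutionOn (c₀ * ν / A ^ 2) ν a w ∧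
        ContinuousInLpOn (Ico 0 (c₀ * ν / A ^ 2)) 2 w ∧
        ∀ δ : ℝ, 0 < δ → ∃ K : ℝ≥0∞, K ≠ ∞ ∧ ∀ t ∈ Ico δ (c₀ * ν / A ^ 2),
          MemHomSobolev (3 / 4 : ℝ) (complexify ∘ w t) ∧
            Function.eHomSobolevSeminorm (3 / 4 : ℝ) (complexify ∘ w t) ≤ K := by
  obtain ⟨C₃, hC₃, hscheme₃⟩ :=
    exists_oseen_fixedPoint_bounded (E := EuclideanSpace ℝ (Fin 3)) (p := 3) (by norm_num) (by norm_num)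
  obtain ⟨C₂, hC₂, hscheme₂⟩ :=
    exists_oseen_fixedPoint_bounded (E := EuclideanSpace ℝ (Fin 3)) (p := 2) (by norm_num) (by norm_num)
  obtain ⟨CB, hCB, hB⟩ := exists_eHomSobolevSeminorm_oseenDuhamel_le (ι := Fin 3)
    (σ := (3 / 4 : ℝ)) (by norm_num) (by norm_num)
  set C : ℝ := max C₃ C₂ with hC_def
  have hC : 0 < C := lt_max_of_lt_left hC₃
  refine ⟨((16 * C)⁻¹) ^ 2, by positivity, ?_⟩
  intro ν A hν hA a ha3 ha2 hdiv hbd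
  set T : ℝ := (16 * C)⁻¹ ^ 2 * ν / A ^ 2 with hT_def
  have hT : 0 < T := by positivity
  -- the smallness condition holds for `C`, hence for `C₃` and `C₂`
  have hsmallC : C * A * ν ^ (-(1 / 2 : ℝ)) * (2 * Real.sqrt T) ≤ 1 / 8 := by
    have hsqrtT : Real.sqrt T = (16 * C)⁻¹ * Real.sqrt ν / A := by
      rw [hT_def, show (16 * C)⁻¹ ^ 2 * ν / A ^ 2 = ((16 * C)⁻¹ * Real.sqrt ν / A) ^ 2 by
        rw [div_pow, mul_pow, Real.sq_sqrt hν.le]]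
      exact Real.sqrt_sq (by positivity)
    have hνν : ν ^ (-(1 / 2 : ℝ)) * Real.sqrt ν = 1 := by
      rw [Real.sqrt_eq_rpow, ← Real.rpow_add hν]
      norm_num
    rw [hsqrtT]
    have : C * A * ν ^ (-(1 / 2 : ℝ)) * (2 * ((16 * C)⁻¹ * Real.sqrt ν / A)) =
        (ν ^ (-(1 / 2 : ℝ)) * Real.sqrt ν) * (2 * C * A * (16 * C)⁻¹ / A) := by ring
    rw [this, hνν, one_mul]
    field_simp
    norm_num
  have hsmall : ∀ {C' : ℝ}, 0 ≤ C' → C' ≤ C → C' * A * ν ^ (-(1 / 2 : ℝ)) * (2 * Real.sqrt T) ≤ 1 / 8 :=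
    fun {C'} hC' hC'C => le_trans (by gcongr) hsmallC
  have hsmall₃ := hsmall hC₃.le (le_max_left _ _)
  have hsmall₂ := hsmall hC₂.le (le_max_right _ _)
  -- a bounded representative of the datum
  obtain ⟨b, hbm, hba, hbA⟩ := exists_bounded_ae_eq ha3.1 hA.le hbd
  have hb3 : MemLp b 3 volume := ha3.ae_eq hba.symm
  have hb2 : MemLp b 2 volume := ha2.ae_eq hba.symm
  have hbdiv : IsWeaklyDivFree b := hdiv.congr_ae hba.symm
  -- Oseen's scheme, twice
  obtain ⟨u, hum, hubd, hu3, husl, hfix⟩ :=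
    hscheme₃ hν hT hA hbm.aestronglyMeasurable hbA hb3 hsmall₃
  obtain ⟨u', hum', hubd', hu2', -, hfix'⟩ :=
    hscheme₂ hν hT hA hbm.aestronglyMeasurable hbA hb2 hsmall₂
  have hA2 : (0 : ℝ) ≤ 2 * A := by positivity
  -- the two fixed points coincide
  have huu' : ∀ t ∈ Ioo 0 T, u t =ᵐ[volume] u' t :=
    oseenMild_bounded_unique (U := fun t x => UnboundedOperators.heatExtension b (ν * t) x) hν hA2
      hum hum' hubd hubd'
      (fun t ht => Eventually.of_forall fun x => hfix t ht x)
      (fun t ht => Eventually.of_forall fun x => hfix' t ht x)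
  have hu2 : ∀ t ∈ Ioo 0 T, eLpNorm (u t) 2 volume ≤ 2 * eLpNorm b 2 volume := fun t ht => by
    rw [eLpNorm_congr_ae (huu' t ht)]
    exact hu2' t ht
  -- the solution: `w 0 = a`, `w t = u t` for `t > 0`
  set w : ℝ → (EuclideanSpace ℝ (Fin 3)) → (EuclideanSpace ℝ (Fin 3)) := fun t x => if 0 < t then u t x else a x with hw_def
  set w' : ℝ → (EuclideanSpace ℝ (Fin 3)) → (EuclideanSpace ℝ (Fin 3)) := fun t x => if 0 < t then u t x else b x with hw'_def
  have hw_pos : ∀ {t : ℝ}, 0 < t → w t = u t := fun ht => funext fun x => if_pos ht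
  have hw'_pos : ∀ {t : ℝ}, 0 < t → w' t = u t := fun ht => funext fun x => if_pos ht
  have hw_zero : w 0 = a := funext fun x => if_neg (lt_irrefl 0)
  have hw'_zero : w' 0 = b := funext fun x => if_neg (lt_irrefl 0)
  have hww' : ∀ t ∈ Ico 0 T, w' t =ᵐ[volume] w t := by
    intro t ht
    rcases ht.1.eq_or_lt with h | h
    · rw [← h, hw_zero, hw'_zero]
      exact hba
    · rw [hw_pos h, hw'_pos h]
  have hslice : ∀ {t : ℝ}, t ∈ Ioo 0 T →
      u t = UnboundedOperators.heatExtension b (ν * t) - oseenDuhamel ν 0 u u t := fun ht =>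
    funext fun x => hfix _ ht x
  have hU_top : ∀ {t : ℝ}, 0 < t → MemLp (UnboundedOperators.heatExtension b (ν * t)) ∞ volume :=
    fun ht => UnboundedOperators.memLp_heatExtension_holds
      (memLp_top_of_bound hbm.aestronglyMeasurable A (Eventually.of_forall hbA)) le_top (mul_pos
          hν ht)
  obtain ⟨C₁, hC₁, hBsup⟩ := exists_norm_oseenDuhamel_le_mul (E := EuclideanSpace ℝ (Fin 3))
  have hB_top : ∀ {t : ℝ}, t ∈ Ioo 0 T → MemLp (oseenDuhamel ν 0 u u t) ∞ volume := fun ht =>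
    memLp_top_of_bound (aestronglyMeasurable_oseenDuhamel hν hum hum hA2 hubd hubd ht.1 ht.2.le) _
      (Eventually.of_forall fun y => hBsup hν ht.1 hA2 hA2
        (fun τ hτ z => hubd τ ⟨hτ.1, hτ.2.trans ht.2⟩ z) (fun τ hτ z => hubd τ ⟨hτ.1, hτ.2.trans
            ht.2⟩ z) y)
  refine ⟨w, ⟨⟨fun t ht => ?_, fun t ht => ?_⟩, ?_, hw_zero, ?_⟩, ?_, ?_⟩
  · -- weak divergence-freeness of the slices
    rcases ht.1.eq_or_lt with h | h
    · rw [← h, hw_zero]; exact hdiv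
    · have htT : t ∈ Ioo 0 T := ⟨h, ht.2⟩
      rw [hw_pos h, hslice htT]
      exact (hbdiv.heatExtension_of_bound hbm.aestronglyMeasurable hbA (mul_pos hν h)).sub le_top
        (isWeaklyDivFree_oseenDuhamel hν hum hum hA2 hubd hubd h ht.2.le) (hU_top h) (hB_top htT)
  · -- the duality identity from `a` at time `t`
    rcases ht.1.eq_or_lt with h | h
    · rw [← h]
      exact isMildNSSolutionFrom_zero_iff.2 fun φ _ _ => by rw [hw_zero]
    · have htT : t ∈ Ioo 0 T := ⟨h, ht.2⟩
      intro φ hφ hφd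
      have hφc := hφ.hasCompactSupport
      have hφcont := hφ.contDiff.continuous
      have hφ1 : MemLp φ 1 volume :=
        memLp_one_iff_integrable.2 (hφcont.integrable_of_hasCompactSupport hφc)
      simp only [Pi.zero_apply, inner_zero_left, integral_zero, intervalIntegral.integral_zero,
        add_zero]
      rw [hw_pos h, hslice htT]
      have hiU : Integrable (fun x => ⟪UnboundedOperators.heatExtension b (ν * t) x, φ x⟫) volume :=
        integrable_inner_of_memLp_conj (p := ∞) (q := 1) (hU_top h) hφ1
      have hiB : Integrable (fun x => ⟪oseenDuhamel ν 0 u u t x, φ x⟫) volume :=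
        integrable_inner_of_memLp_conj (p := ∞) (q := 1) (hB_top htT) hφ1
      have hsplit : ∫ x, ⟪(UnboundedOperators.heatExtension b (ν * t) - oseenDuhamel ν 0 u u t) x,
          φ x⟫ =
          (∫ x, ⟪UnboundedOperators.heatExtension b (ν * t) x, φ x⟫) -
            ∫ x, ⟪oseenDuhamel ν 0 u u t x, φ x⟫ := by
        rw [← integral_sub hiU hiB]
        refine integral_congr_ae (Eventually.of_forall fun x => ?_)
        simp only [Pi.sub_apply, inner_sub_left]
      rw [hsplit]
      have hfree : ∫ x, ⟪UnboundedOperators.heatExtension b (ν * t) x, φ x⟫ =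
          ∫ x, ⟪a x, heatTest ν φ t x⟫ := by
        rw [integral_inner_heatExtension_comm_of_bound hbm.aestronglyMeasurable hbA hφcont hφc
            (mul_pos hν h),
          heatTest_of_pos hν h]
        refine integral_congr_ae ?_
        filter_upwards [hba] with x hx
        rw [hx]
      have hduh := integral_inner_oseenDuhamel_eq_neg_intervalIntegral hν hum hA2 hubd h ht.2.le
          hφ hφd
      rw [hfree, hduh, sub_neg_eq_add]
      congr 1
      refine intervalIntegral.integral_congr_ae ?_
      refine Eventually.of_forall fun τ hτ => ?_
      rw [uIoc_of_le h.le] at hτ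
      simp only [hw_pos hτ.1]
  · -- continuity in `L³` on `[0, T)`
    have hcont := continuousInLpOn_oseen_fixedPoint (E := EuclideanSpace ℝ (Fin 3)) (p := 3)
      (by norm_num) (by norm_num) hν hbm.aestronglyMeasurable hbA hb3 hum hA2 hubd
      (L := (2 * eLpNorm b 3 volume).toNNReal) (fun t ht => ?_) husl hfix
    · exact hcont.congr_ae_slice hww'
    · rw [ENNReal.coe_toNNReal (ENNReal.mul_ne_top ENNReal.ofNat_ne_top hb3.eLpNorm_ne_top)]
      exact hu3 t ht
  · -- measurability on the slab: `w = u` there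
    refine hum.congr ?_
    filter_upwards [ae_restrict_mem (measurableSet_Ioo.prod MeasurableSet.univ)] with q hq
    show u q.1 q.2 = w q.1 q.2
    rw [hw_pos (mem_prod.1 hq).1.1]
  · -- continuity in `L²` on `[0, T)`
    have hcont := continuousInLpOn_oseen_fixedPoint (E := EuclideanSpace ℝ (Fin 3)) (p := 2)
      (by norm_num) (by norm_num) hν hbm.aestronglyMeasurable hbA hb2 hum hA2 hubd
      (L := (2 * eLpNorm b 2 volume).toNNReal) (fun t ht => ?_) husl hfix
    · exact hcont.congr_ae_slice hww'
    · rw [ENNReal.coe_toNNReal (ENNReal.mul_ne_top ENNReal.ofNat_ne_top hb2.eLpNorm_ne_top)]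
      exact hu2 t ht
  · -- `Ḣ^{3/4}` smoothing on `[δ, T)`
    intro δ hδ
    set L₂ : ℝ≥0 := (2 * eLpNorm b 2 volume).toNNReal with hL₂
    have hL₂eq : (L₂ : ℝ≥0∞) = 2 * eLpNorm b 2 volume :=
      ENNReal.coe_toNNReal (ENNReal.mul_ne_top ENNReal.ofNat_ne_top hb2.eLpNorm_ne_top)
    have hcb2 : MemLp (complexify ∘ b) 2 volume := memLp_complexify_comp hb2
    -- the constants
    set Kh : ℝ≥0∞ := ENNReal.ofReal ((8 * Real.pi ^ 2 * (ν * δ)) ^ (-((3 / 4 : ℝ) / 2))) *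
      eLpNorm (complexify ∘ b) 2 volume with hKh
    set KB : ℝ≥0∞ := ENNReal.ofReal (CB * ν ^ (-((1 + 3 / 4 : ℝ) / 2)) *
      T ^ ((1 - 3 / 4 : ℝ) / 2) * (2 * A)) * L₂ with hKB
    refine ⟨Kh + KB, ENNReal.add_ne_top.2 ⟨ENNReal.mul_ne_top ENNReal.ofReal_ne_top hcb2.eLpNorm_ne_top,
      ENNReal.mul_ne_top ENNReal.ofReal_ne_top ENNReal.coe_ne_top⟩, fun t ht => ?_⟩
    have ht0 : 0 < t := hδ.trans_le ht.1
    have htT : t ∈ Ioo 0 T := ⟨ht0, ht.2⟩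
    have hu2' : ∀ τ ∈ Ioo 0 T, MemLp (u τ) 2 volume ∧ eLpNorm (u τ) 2 volume ≤ L₂ := fun τ hτ =>
      ⟨⟨husl τ hτ, (hu2 τ hτ).trans_lt (by rw [← hL₂eq]; exact ENNReal.coe_lt_top)⟩,
        by rw [hL₂eq]; exact hu2 τ hτ⟩
    obtain ⟨-, hBmem, hBle⟩ := hB hν hum hA2 hubd hu2' ht0 ht.2.le
    -- the heat part
    have hheat_eq : complexify ∘ UnboundedOperators.heatExtension b (ν * t) =
        UnboundedOperators.heatExtension (complexify ∘ b) (ν * t) :=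
      FunctionSpaces.EuclideanSpace.complexify_comp_heatExtension b (ν * t)
    have hνt : 0 < ν * t := mul_pos hν ht0
    have hHmem : MemHomSobolev (3 / 4 : ℝ) (complexify ∘ UnboundedOperators.heatExtension b (ν * t)) := by
      rw [hheat_eq]
      exact FunctionSpaces.memHomSobolev_heatExtension hcb2 hνt (by norm_num) (by norm_num)
    have hHle : Function.eHomSobolevSeminorm (3 / 4 : ℝ)
        (complexify ∘ UnboundedOperators.heatExtension b (ν * t)) ≤ Kh := by
      rw [hheat_eq, hKh]
      refine (Function.eHomSobolevSeminorm_heatExtension_le_eLpNorm hcb2 hνt (s := (3 / 4 : ℝ))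
        (by norm_num) (by norm_num)).trans (mul_le_mul' (ENNReal.ofReal_le_ofReal ?_) le_rfl)
      exact Real.rpow_le_rpow_of_nonpos (by positivity)
        (mul_le_mul_of_nonneg_left (mul_le_mul_of_nonneg_left ht.1 hν.le) (by positivity))
        (by norm_num)
    -- the Duhamel part on `[δ, T)`: `t^{1/8} ≤ T^{1/8}`
    have hBle' : Function.eHomSobolevSeminorm (3 / 4 : ℝ) (complexify ∘ oseenDuhamel ν 0 u u t) ≤ KB := by
      refine hBle.trans ?_
      rw [hKB]
      refine mul_le_mul' (ENNReal.ofReal_le_ofReal ?_) le_rfl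
      have h1 : t ^ ((1 - 3 / 4 : ℝ) / 2) ≤ T ^ ((1 - 3 / 4 : ℝ) / 2) :=
        Real.rpow_le_rpow ht0.le ht.2.le (by norm_num)
      have h2 : 0 ≤ CB * ν ^ (-((1 + 3 / 4 : ℝ) / 2)) := by positivity
      nlinarith [mul_le_mul_of_nonneg_left h1 h2, hA.le]
    -- the slice
    have hwt : complexify ∘ w t = complexify ∘ UnboundedOperators.heatExtension b (ν * t) -
        complexify ∘ oseenDuhamel ν 0 u u t := by
      rw [hw_pos ht0, hslice htT]
      funext x
      simp only [Function.comp_apply, Pi.sub_apply, map_sub]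
    rw [hwt]
    exact ⟨hHmem.sub hBmem, (Function.eHomSobolevSeminorm_sub_le _ _ _).trans (add_le_add hHle hBle')⟩

end Window

/-! ### `Ḣ^{1/2}`-continuity from `L²`-continuity and an `Ḣ^{3/4}` bound (interpolation) -/

section Criterion

/-- **The `Ḣ^{1/2}` distance through interpolation**: for `f, g ∈ L²(ℝ³; ℝ³)` whose
complexifications have `Ḣ^{3/4}` seminorm at most `K`,
`‖f - g‖_{Ḣ^{1/2}} ≤ ‖f - g‖_{L²}^{1/3} (2K)^{2/3}` (Bahouri–Chemin–Danchin 2011, Prop. 1.32 with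
`s = 1/2` between `0` and `3/4`; `Function.eHomSobolevSeminorm_le_eLpNorm_rpow_mul_rpow`).
[cite: BahouriCheminDanchin2011, Prop. 1.32] -/
theorem eHomSobolevSeminorm_half_sub_le {f g : (EuclideanSpace ℝ (Fin 3)) → (EuclideanSpace ℝ (Fin 3))} (hf2 : MemLp f 2 volume)
    (hg2 : MemLp g 2 volume) {K : ℝ≥0∞}
    (hf : Function.eHomSobolevSeminorm (3 / 4 : ℝ) (complexify ∘ f) ≤ K)
    (hg : Function.eHomSobolevSeminorm (3 / 4 : ℝ) (complexify ∘ g) ≤ K) :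
    Function.eHomSobolevSeminorm (1 / 2 : ℝ) (complexify ∘ (f - g)) ≤
      eLpNorm (f - g) 2 volume ^ (1 / 3 : ℝ) * (K + K) ^ (2 / 3 : ℝ) := by
  have hfg2 : MemLp (complexify ∘ (f - g)) 2 volume := memLp_complexify_comp (hf2.sub hg2)
  have h := Function.eHomSobolevSeminorm_le_eLpNorm_rpow_mul_rpow (s := (1 / 2 : ℝ))
    (s₁ := (3 / 4 : ℝ)) (by norm_num) (by norm_num) (by norm_num) hfg2
  have e1 : ((3 / 4 : ℝ) - 1 / 2) / (3 / 4) = 1 / 3 := by norm_num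
  have e2 : (1 / 2 : ℝ) / (3 / 4) = 2 / 3 := by norm_num
  rw [e1, e2] at h
  have hnorm : eLpNorm (complexify ∘ (f - g)) 2 volume = eLpNorm (f - g) 2 volume :=
    eLpNorm_congr_norm_ae (Eventually.of_forall fun x => by
      simp only [Function.comp_apply, Pi.sub_apply]
      exact FunctionSpaces.EuclideanSpace.norm_complexify _)
  have hsub : complexify ∘ (f - g) = complexify ∘ f - complexify ∘ g := by
    funext x
    simp only [Function.comp_apply, Pi.sub_apply, map_sub]
  refine h.trans (mul_le_mul' (by rw [hnorm]) ?_)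
  gcongr
  rw [hsub]
  exact (Function.eHomSobolevSeminorm_sub_le _ _ _).trans (add_le_add hf hg)

/-- **`Ḣ^{1/2}`-continuity from `L²`-continuity and a local `Ḣ^{3/4}` bound**: along a filter
`l`, if `‖u(t) - u(t₀)‖_{L²} → 0`, the slices are eventually in `L²`, and the `Ḣ^{3/4}`
seminorms are eventually bounded by a finite `K` (also at `t₀`), then
`‖u(t) - u(t₀)‖_{Ḣ^{1/2}} → 0` (squeeze with `eHomSobolevSeminorm_half_sub_le`).
[cite: BahouriCheminDanchin2011, Prop. 1.32] -/
theorem tendsto_eHomSobolevSeminorm_half_of_tendsto_eLpNorm {l : Filter ℝ} {u : ℝ → (EuclideanSpace ℝ (Fin 3)) → (EuclideanSpace ℝ (Fin 3))}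
    {t₀ : ℝ} {K : ℝ≥0∞} (hK : K ≠ ∞)
    (h2 : Tendsto (fun t => eLpNorm (u t - u t₀) 2 volume) l (𝓝 0))
    (hmem : ∀ᶠ t in l, MemLp (u t) 2 volume) (hmem₀ : MemLp (u t₀) 2 volume)
    (hb : ∀ᶠ t in l, Function.eHomSobolevSeminorm (3 / 4 : ℝ) (complexify ∘ u t) ≤ K)
    (hb₀ : Function.eHomSobolevSeminorm (3 / 4 : ℝ) (complexify ∘ u t₀) ≤ K) :
    Tendsto (fun t => Function.eHomSobolevSeminorm (1 / 2 : ℝ) (complexify ∘ (u t - u t₀))) l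
      (𝓝 0) := by
  have hlim : Tendsto (fun t => eLpNorm (u t - u t₀) 2 volume ^ (1 / 3 : ℝ) * (K + K) ^ (2 / 3 : ℝ))
      l (𝓝 0) := by
    have h1 := ((ENNReal.continuous_rpow_const (y := (1 / 3 : ℝ))).tendsto 0).comp h2
    rw [ENNReal.zero_rpow_of_pos (by norm_num)] at h1
    have h3 := ENNReal.Tendsto.mul_const h1 (b := (K + K) ^ (2 / 3 : ℝ)) (Or.inr
      (ENNReal.rpow_ne_top_of_nonneg (by norm_num) (ENNReal.add_ne_top.2 ⟨hK, hK⟩)))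
    rw [zero_mul] at h3
    exact h3
  refine tendsto_of_tendsto_of_tendsto_of_le_of_le' tendsto_const_nhds hlim
    (Eventually.of_forall fun t => zero_le) ?_
  filter_upwards [hmem, hb] with t ht htb
  exact eHomSobolevSeminorm_half_sub_le ht hmem₀ htb hb₀

/-- Neighbourhoods within `S` at `t₀` coincide with neighbourhoods within any `W ⊆ S` that is itself
a neighbourhood of `t₀` within `S`. [folklore] -/
theorem nhdsWithin_eq_nhdsWithin_of_mem_of_subset {S W : Set ℝ} {t₀ : ℝ} (hW : W ∈ 𝓝[S] t₀)
    (hWS : W ⊆ S) : 𝓝[S] t₀ = 𝓝[W] t₀ := by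
  rw [← nhdsWithin_inter_of_mem hW, Set.inter_eq_left.2 hWS]

end Criterion

/-! ### Near `t = 0`: the Fujita–Kato class of a mild `C_t L³` solution -/

section NearZero

variable {ν T : ℝ} {u₀ : (EuclideanSpace ℝ (Fin 3)) → (EuclideanSpace ℝ (Fin 3))} {u : ℝ → (EuclideanSpace ℝ (Fin 3)) → (EuclideanSpace ℝ (Fin 3))}

/-- **Near `t = 0` a mild `C([0,T); L³)` solution from `u₀ ∈ Ḣ^{1/2} ∩ L²` is in the Fujita–Kato
class**: there is `0 < T₁ ≤ T` with `u ∈ C([0,T₁); Ḣ^{1/2} ∩ L²) ∩ C([0,T₁); L²)` — the local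
Fujita–Kato solution (`fujita_kato_local_holds`, Lemarié-Rieusset 2016, Thm. 7.4) lies in
`C_t L³` and agrees with `u` a.e. at every time (`kato_unique_holds`, Thm. 7.7); both classes only
see slices up to null sets. (Finite-horizon twin of `exists_fujitaKato_class_near_zero`.)
[cite: LemarieRieusset2016, Thm. 7.4 with Thm. 7.7] -/
theorem exists_fujitaKato_class_near_zero_Ico (hν : 0 < ν) (hT : 0 < T)
    (hu₀ : MemHomSobolev (1 / 2 : ℝ) (complexify ∘ u₀)) (hdiv : IsWeaklyDivFree u₀)
    (hmild : IsMildNSSolutionOn (Ico 0 T) ν 0 u₀ u) (huc : ContinuousInLpOn (Ico 0 T) 3 u)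
    (hmeas : AEStronglyMeasurable (uncurry u) (volume.restrict (Ioo 0 T ×ˢ univ))) :
    ∃ T₁ : ℝ, 0 < T₁ ∧ T₁ ≤ T ∧ ContinuousInHomSobolevOn (Ico 0 T₁) (1 / 2 : ℝ) u ∧
      ContinuousInLpOn (Ico 0 T₁) 2 u := by
  obtain ⟨T₀, hT₀, v, hv, hvH, hv2, -, hvmeas⟩ := fujita_kato_local_holds ν hν u₀ hu₀ hdiv
  have hT₁ : 0 < min T₀ T := lt_min hT₀ hT
  have hu₀3 : MemLp u₀ 3 volume :=
    memLp_three_of_memHomSobolev_half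
      FunctionSpaces.eLpNorm_three_le_eHomSobolevSeminorm_half_holds hu₀
  have hsub₁ : Ico 0 (min T₀ T) ⊆ Ico 0 T₀ := Ico_subset_Ico_right (min_le_left _ _)
  have hsub₂ : Ico 0 (min T₀ T) ⊆ Ico 0 T := Ico_subset_Ico_right (min_le_right _ _)
  have hmeasu : AEStronglyMeasurable (uncurry u) (volume.restrict (Ioo 0 (min T₀ T) ×ˢ univ)) :=
    hmeas.mono_measure (Measure.restrict_mono
      (prod_mono (Ioo_subset_Ioo_right (min_le_right _ _)) subset_rfl) le_rfl)
  have hmeasv : AEStronglyMeasurable (uncurry v) (volume.restrict (Ioo 0 (min T₀ T) ×ˢ univ)) :=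
    hvmeas.mono_measure (Measure.restrict_mono
      (prod_mono (Ioo_subset_Ioo_right (min_le_left _ _)) subset_rfl) le_rfl)
  have hae : ∀ t ∈ Ico 0 (min T₀ T), u t =ᵐ[volume] v t :=
    kato_unique_holds hν hu₀3 (hmild.mono hsub₂) (hv.mono hsub₁) (huc.mono hsub₂)
      (hvH.mono hsub₁).continuousInLpOn_three hmeasu hmeasv
  exact ⟨min T₀ T, hT₁, min_le_right _ _, (hvH.mono hsub₁).congr_ae_slices hae,
    (hv2.mono hsub₁).congr_ae_slices hae⟩

end NearZero

/-! ### One window: restart at `s`, uniqueness, transport of the classes -/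

section WindowStep

variable {ν T M T_A T_w : ℝ} {u₀ : (EuclideanSpace ℝ (Fin 3)) → (EuclideanSpace ℝ (Fin 3))} {v : ℝ → (EuclideanSpace ℝ (Fin 3)) → (EuclideanSpace ℝ (Fin 3))}

/-- **One window of the persistence argument.** Let `v` be a mild `C([0,T); L³)` solution from
`u₀ ∈ L³`, measurable on the slab, with `‖v(t)‖_∞ ≤ M` on `(0, T)`; suppose every weakly
divergence-free `a ∈ L³ ∩ L²` with `‖a‖_∞ ≤ M` is the datum of a Kato solution on `[0, T_A)` lying
in `C_t L²` and smoothed in `Ḣ^{3/4}` away from `0` (`exists_kato_window_L2H`), and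
`0 < T_w ≤ T_A`. If `0 < s < T` and `v(s) ∈ L²`, then `v ∈ C([s, min(s+T_w, T)); L²)` and
`v(t) ∈ Ḣ^{3/4} ∩ L²` with a common bound for `t ∈ [s + T_w/8, min(s+T_w, T))`: the window
solution from `v(s)` agrees a.e. with the restarted `v(· + s)` (`mild_L3_restart_holds`,
`kato_unique_holds`), and both classes only see slices up to null sets
(Lemarié-Rieusset 2016, proof of Thm. 15.1 (A), p. 565; Rusin–Šverák 2011, §3, "this can be
iterated forward"). [cite: LemarieRieusset2016, Thm. 15.1 (A) (proof, PDF p. 565)] -/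
theorem persistence_window_step (hν : 0 < ν) (hT : 0 < T) (hu₀3 : MemLp u₀ 3 volume)
    (hv : IsMildNSSolutionOn (Ico 0 T) ν 0 u₀ v) (hvc : ContinuousInLpOn (Ico 0 T) 3 v)
    (hmeas : AEStronglyMeasurable (uncurry v) (volume.restrict (Ioo 0 T ×ˢ univ)))
    (hbdd : ∀ t ∈ Ioo 0 T, eLpNorm (v t) ∞ volume ≤ ENNReal.ofReal M)
    (hwin : ∀ {a : (EuclideanSpace ℝ (Fin 3)) → (EuclideanSpace ℝ (Fin 3))}, MemLp a 3 volume → MemLp a 2 volume → IsWeaklyDivFree a →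
      eLpNorm a ∞ volume ≤ ENNReal.ofReal M →
      ∃ w : ℝ → (EuclideanSpace ℝ (Fin 3)) → (EuclideanSpace ℝ (Fin 3)), IsKatoSolutionOn T_A ν a w ∧ ContinuousInLpOn (Ico 0 T_A) 2 w ∧
        ∀ δ : ℝ, 0 < δ → ∃ K : ℝ≥0∞, K ≠ ∞ ∧ ∀ t ∈ Ico δ T_A,
          MemHomSobolev (3 / 4 : ℝ) (complexify ∘ w t) ∧
            Function.eHomSobolevSeminorm (3 / 4 : ℝ) (complexify ∘ w t) ≤ K)
    (hTw : 0 < T_w) (hTwA : T_w ≤ T_A) {s : ℝ} (hs0 : 0 < s) (hsT : s < T)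
    (hs2 : MemLp (v s) 2 volume) :
    ContinuousInLpOn (Ico s (min (s + T_w) T)) 2 v ∧
      ∃ K : ℝ≥0∞, K ≠ ∞ ∧ ∀ t ∈ Ico (s + T_w / 8) (min (s + T_w) T),
        MemHomSobolev (3 / 4 : ℝ) (complexify ∘ v t) ∧
          Function.eHomSobolevSeminorm (3 / 4 : ℝ) (complexify ∘ v t) ≤ K := by
  have hsI : s ∈ Ico 0 T := ⟨hs0.le, hsT⟩
  have ha3 : MemLp (v s) 3 volume := hvc.1 s hsI
  obtain ⟨w, hK, hw2, hwH⟩ := hwin ha3 hs2 (hv.1 s hsI) (hbdd s ⟨hs0, hsT⟩)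
  -- the restarted solution `v(· + s)` on `[0, T - s)`
  have htr : IsMildNSSolutionOn (Ico 0 (T - s)) ν 0 (v s) (fun t => v (t + s)) :=
    isMildNSSolutionOn_translate_of_restart mild_L3_restart_holds hν hT hu₀3 hv hvc hmeas hsI
  have htrc : ContinuousInLpOn (Ico 0 (T - s)) 3 (fun t => v (t + s)) :=
    hvc.translate_Ico hs0.le le_rfl
  have htrm : AEStronglyMeasurable (uncurry fun t => v (t + s))
      (volume.restrict (Ioo 0 (T - s) ×ˢ univ)) :=
    aestronglyMeasurable_uncurry_translate hs0.le hmeas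
  -- the common interval `[0, T')`, `T' = min T_w (T - s)`
  set T' : ℝ := min T_w (T - s) with hT'_def
  have hT'A : Ico 0 T' ⊆ Ico 0 T_A := Ico_subset_Ico_right ((min_le_left _ _).trans hTwA)
  have hT's : Ico 0 T' ⊆ Ico 0 (T - s) := Ico_subset_Ico_right (min_le_right _ _)
  have hmw : AEStronglyMeasurable (uncurry w) (volume.restrict (Ioo 0 T' ×ˢ univ)) :=
    hK.2.2.2.mono_measure (Measure.restrict_mono
      (prod_mono (Ioo_subset_Ioo_right ((min_le_left _ _).trans hTwA)) subset_rfl) le_rfl)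
  have hmtr : AEStronglyMeasurable (uncurry fun t => v (t + s))
      (volume.restrict (Ioo 0 T' ×ˢ univ)) :=
    htrm.mono_measure (Measure.restrict_mono
      (prod_mono (Ioo_subset_Ioo_right (min_le_right _ _)) subset_rfl) le_rfl)
  have hae : ∀ t ∈ Ico 0 T', w t =ᵐ[volume] v (t + s) :=
    kato_unique_holds hν ha3 (hK.1.mono hT'A) (htr.mono hT's) (hK.2.1.mono hT'A) (htrc.mono hT's)
      hmw hmtr
  -- `L²` continuity on the window
  have h2tr : ContinuousInLpOn (Ico 0 T') 2 (fun t => v (t + s)) :=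
    (hw2.mono hT'A).congr_ae_slice hae
  have hsT' : s + T' = min (s + T_w) T := by
    rw [hT'_def, ← min_add_add_left, add_sub_cancel]
  have h2v : ContinuousInLpOn (Ico s (min (s + T_w) T)) 2 v := by
    rw [← hsT']
    refine ContinuousInLpOn.of_translate_Ico (T := s + T') (s := s) ?_
    rwa [add_sub_cancel_left]
  -- `Ḣ^{3/4}` away from the window start
  obtain ⟨K, hKtop, hH⟩ := hwH (T_w / 8) (by positivity)
  refine ⟨h2v, K, hKtop, fun t ht => ?_⟩
  obtain ⟨ht1, ht2⟩ := lt_min_iff.1 ht.2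
  have hτ : t - s ∈ Ico 0 T' := ⟨by linarith [ht.1], lt_min (by linarith) (by linarith)⟩
  have hτδ : t - s ∈ Ico (T_w / 8) T_A :=
    ⟨by linarith [ht.1], hτ.2.trans_le ((min_le_left _ _).trans hTwA)⟩
  obtain ⟨hm, hle⟩ := hH (t - s) hτδ
  have hae_t : w (t - s) =ᵐ[volume] v t := by
    have := hae (t - s) hτ
    rwa [sub_add_cancel] at this
  have hae_c : complexify ∘ w (t - s) =ᵐ[volume] complexify ∘ v t :=
    hae_t.mono fun x hx => by simp only [Function.comp_apply, hx]
  refine ⟨hm.congr_ae hae_c, ?_⟩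
  rw [← Function.eHomSobolevSeminorm_congr_ae hae_c]
  exact hle

end WindowStep

/-! ### The analytic core and the discharges -/

section Core

/-- **Discharge of `bounded_mild_fujitaKato_persistence`** (the analytic core of
`rusinSverakRhoMaxPure_le`, `RusinSverakRhoMaxPureLe.lean`; Lemarié-Rieusset 2016, Thm. 15.2 /
proof of Thm. 15.1 (A), p. 565; Rusin–Šverák 2011, §3): a bounded mild `C([0,T); L³)` solution
from `u₀ ∈ Ḣ^{1/2} ∩ L²` lies in `C([0,T); Ḣ^{1/2} ∩ L²) ∩ C([0,T); L²)`. Near `t = 0` by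
`exists_fujitaKato_class_near_zero_Ico`; then by induction over the windows
`[sₖ, sₖ + T_w)`, `sₖ = T₁/2 + k T_w/2`, `T_w = min (c₀ν/M²) (T₁/2)` (`persistence_window_step`),
which transport `L²`-continuity and `Ḣ^{3/4}` bounds; `Ḣ^{1/2}`-membership and continuity follow
by interpolation (`tendsto_eHomSobolevSeminorm_half_of_tendsto_eLpNorm`, `MemHomSobolev.of_le`).
[cite: LemarieRieusset2016, Thm. 15.2 and Thm. 15.1 (A) (proof, PDF p. 565)] -/
theorem bounded_mild_fujitaKato_persistence_holds : bounded_mild_fujitaKato_persistence := by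
  intro ν T hν hT u₀ v hH hv hvc hv0 hmeas hbdd
  obtain ⟨M₀, hM₀⟩ := hbdd
  set M : ℝ := max M₀ 1 with hM_def
  have hM : 0 < M := lt_max_of_lt_right one_pos
  have hbd : ∀ t ∈ Ioo 0 T, eLpNorm (v t) ∞ volume ≤ ENNReal.ofReal M := fun t ht =>
    (hM₀ t ht).trans (ENNReal.ofReal_le_ofReal (le_max_left _ _))
  have hdiv₀ : IsWeaklyDivFree u₀ := by
    rw [← hv0]
    exact hv.1 0 ⟨le_rfl, hT⟩
  have hu₀3 : MemLp u₀ 3 volume :=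
    memLp_three_of_memHomSobolev_half
      FunctionSpaces.eLpNorm_three_le_eHomSobolevSeminorm_half_holds hH
  -- near `t = 0`
  obtain ⟨T₁, hT₁, hT₁T, hH₁, h2₁⟩ :=
    exists_fujitaKato_class_near_zero_Ico hν hT hH hdiv₀ hv hvc hmeas
  rcases hT₁T.eq_or_lt with hEq | hT₁T'
  · rw [hEq] at hH₁ h2₁
    exact ⟨hH₁, h2₁⟩
  -- the windows
  obtain ⟨c₀, hc₀, hwin₀⟩ := exists_kato_window_L2H
  set T_A : ℝ := c₀ * ν / M ^ 2 with hTA_def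
  have hTA : 0 < T_A := by positivity
  have hwin : ∀ {a : (EuclideanSpace ℝ (Fin 3)) → (EuclideanSpace ℝ (Fin 3))}, MemLp a 3 volume → MemLp a 2 volume → IsWeaklyDivFree a →
      eLpNorm a ∞ volume ≤ ENNReal.ofReal M →
      ∃ w : ℝ → (EuclideanSpace ℝ (Fin 3)) → (EuclideanSpace ℝ (Fin 3)), IsKatoSolutionOn T_A ν a w ∧ ContinuousInLpOn (Ico 0 T_A) 2 w ∧
        ∀ δ : ℝ, 0 < δ → ∃ K : ℝ≥0∞, K ≠ ∞ ∧ ∀ t ∈ Ico δ T_A,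
          MemHomSobolev (3 / 4 : ℝ) (complexify ∘ w t) ∧
            Function.eHomSobolevSeminorm (3 / 4 : ℝ) (complexify ∘ w t) ≤ K :=
    fun ha3 ha2 hdiv hbd' => hwin₀ hν hM ha3 ha2 hdiv hbd'
  set T_w : ℝ := min T_A (T₁ / 2) with hTw_def
  have hTw : 0 < T_w := lt_min hTA (half_pos hT₁)
  have hTwA : T_w ≤ T_A := min_le_left _ _
  have hTw₁ : T_w ≤ T₁ / 2 := min_le_right _ _
  set s₀ : ℝ := T₁ / 2 with hs₀_def
  set h : ℝ := T_w / 2 with hh_def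
  have hh : 0 < h := by positivity
  set sk : ℕ → ℝ := fun k => s₀ + k * h with hsk_def
  have hsk_pos : ∀ k, 0 < sk k := fun k => by
    have : (0 : ℝ) ≤ k * h := by positivity
    simp only [hsk_def]
    linarith
  have hsk_succ : ∀ k, sk (k + 1) = sk k + h := fun k => by
    simp only [hsk_def, Nat.cast_add, Nat.cast_one]
    ring
  have STEP : ∀ {s : ℝ}, 0 < s → s < T → MemLp (v s) 2 volume →
      ContinuousInLpOn (Ico s (min (s + T_w) T)) 2 v ∧
        ∃ K : ℝ≥0∞, K ≠ ∞ ∧ ∀ t ∈ Ico (s + T_w / 8) (min (s + T_w) T),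
          MemHomSobolev (3 / 4 : ℝ) (complexify ∘ v t) ∧
            Function.eHomSobolevSeminorm (3 / 4 : ℝ) (complexify ∘ v t) ≤ K :=
    fun hs0 hsT hs2 => persistence_window_step hν hT hu₀3 hv hvc hmeas hbd hwin hTw hTwA hs0 hsT hs2
  -- induction over the windows
  have hind : ∀ k : ℕ, sk k < T → MemLp (v (sk k)) 2 volume ∧
      (ContinuousInLpOn (Ico (sk k) (min (sk k + T_w) T)) 2 v ∧
        ∃ K : ℝ≥0∞, K ≠ ∞ ∧ ∀ t ∈ Ico (sk k + T_w / 8) (min (sk k + T_w) T),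
          MemHomSobolev (3 / 4 : ℝ) (complexify ∘ v t) ∧
            Function.eHomSobolevSeminorm (3 / 4 : ℝ) (complexify ∘ v t) ≤ K) := by
    intro k
    induction k with
    | zero =>
      intro hs
      have h0 : sk 0 = s₀ := by simp only [hsk_def, Nat.cast_zero, zero_mul, add_zero]
      rw [h0] at hs ⊢
      have hs₀mem : s₀ ∈ Ico 0 T₁ := ⟨by positivity, by rw [hs₀_def]; linarith⟩
      have hm : MemLp (v s₀) 2 volume := h2₁.1 _ hs₀mem
      exact ⟨hm, STEP (by positivity) hs hm⟩
    | succ k ih =>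
      intro hs
      have hlt : sk k < sk (k + 1) := by rw [hsk_succ]; linarith
      obtain ⟨-, hc, -⟩ := ih (hlt.trans hs)
      have hmem : sk (k + 1) ∈ Ico (sk k) (min (sk k + T_w) T) := by
        refine ⟨hlt.le, lt_min ?_ hs⟩
        rw [hsk_succ, hh_def]
        linarith
      have hm : MemLp (v (sk (k + 1))) 2 volume := hc.1 _ hmem
      exact ⟨hm, STEP (hsk_pos _) hs hm⟩
  -- locating a time `t ≥ s₀ + h/2` well inside a window
  have hloc : ∀ t : ℝ, s₀ + h / 2 ≤ t → ∃ k : ℕ, sk k + h / 2 ≤ t ∧ t < sk k + 3 * h / 2 := by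
    intro t ht
    have hx : 0 ≤ (t - s₀ - h / 2) / h := div_nonneg (by linarith) hh.le
    refine ⟨⌊(t - s₀ - h / 2) / h⌋₊, ?_, ?_⟩
    · have hk : (⌊(t - s₀ - h / 2) / h⌋₊ : ℝ) ≤ (t - s₀ - h / 2) / h := Nat.floor_le hx
      have := mul_le_mul_of_nonneg_right hk hh.le
      rw [div_mul_cancel₀ _ hh.ne'] at this
      simp only [hsk_def]
      linarith
    · have hk : (t - s₀ - h / 2) / h < ⌊(t - s₀ - h / 2) / h⌋₊ + 1 := Nat.lt_floor_add_one _
      have := mul_lt_mul_of_pos_right hk hh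
      rw [div_mul_cancel₀ _ hh.ne', add_mul, one_mul] at this
      simp only [hsk_def]
      linarith
  have hs₀T₁ : s₀ + h / 2 < T₁ := by
    rw [hs₀_def, hh_def]
    linarith
  -- the window of a time `t₀ ≥ T₁`: data
  have hwindow : ∀ t₀ ∈ Ico 0 T, T₁ ≤ t₀ → ∃ k : ℕ, sk k < T ∧
      t₀ ∈ Ico (sk k + T_w / 8) (min (sk k + T_w) T) ∧
      Ico (sk k) (min (sk k + T_w) T) ∈ 𝓝[Ico 0 T] t₀ ∧
      Ico (sk k) (min (sk k + T_w) T) ⊆ Ico 0 T ∧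
      Ioi (sk k + T_w / 8) ∈ 𝓝 t₀ := by
    intro t₀ ht₀ ht₀T₁
    obtain ⟨k, hk1, hk2⟩ := hloc t₀ (hs₀T₁.le.trans ht₀T₁)
    have hskt : sk k < t₀ := by linarith
    have ht₀w : t₀ < sk k + T_w := by rw [hh_def] at hk2; linarith
    have hlt : t₀ < min (sk k + T_w) T := lt_min ht₀w ht₀.2
    have h8 : sk k + T_w / 8 < t₀ := by rw [hh_def] at hk1; linarith
    refine ⟨k, hskt.trans ht₀.2, ⟨h8.le, hlt⟩, ?_, ?_, Ioi_mem_nhds h8⟩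
    · exact mem_nhdsWithin_of_mem_nhds
        (mem_of_superset (Ioo_mem_nhds hskt hlt) Ioo_subset_Ico_self)
    · exact fun t ht => ⟨(hsk_pos k).le.trans ht.1, ht.2.trans_le (min_le_right _ _)⟩
  have hnear : ∀ t₀ ∈ Ico 0 T, t₀ < T₁ → Ico 0 T₁ ∈ 𝓝[Ico 0 T] t₀ := fun t₀ _ ht => by
    refine mem_of_superset (inter_mem_nhdsWithin (Ico 0 T) (Iio_mem_nhds ht)) fun t ht' => ?_
    exact ⟨ht'.1.1, ht'.2⟩
  have hsub₁ : Ico 0 T₁ ⊆ Ico 0 T := Ico_subset_Ico_right hT₁T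
  -- the `L²` class on `[0, T)`
  have h2 : ContinuousInLpOn (Ico 0 T) 2 v := by
    refine ⟨fun t ht => ?_, fun t₀ ht₀ => ?_⟩
    · by_cases htT : t < T₁
      · exact h2₁.1 t ⟨ht.1, htT⟩
      · obtain ⟨k, hk, hkw, -, -, -⟩ := hwindow t ht (not_lt.1 htT)
        exact (hind k hk).2.1.1 t ⟨by linarith [hkw.1], hkw.2⟩
    · by_cases htT : t₀ < T₁
      · rw [nhdsWithin_eq_nhdsWithin_of_mem_of_subset (hnear t₀ ht₀ htT) hsub₁]
        exact h2₁.2 t₀ ⟨ht₀.1, htT⟩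
      · obtain ⟨k, hk, hkw, hW, hWS, -⟩ := hwindow t₀ ht₀ (not_lt.1 htT)
        rw [nhdsWithin_eq_nhdsWithin_of_mem_of_subset hW hWS]
        exact (hind k hk).2.1.2 t₀ ⟨by linarith [hkw.1], hkw.2⟩
  refine ⟨⟨fun t ht => ?_, fun t₀ ht₀ => ?_⟩, h2⟩
  · -- membership in `Ḣ^{1/2} ∩ L²`
    by_cases htT : t < T₁
    · exact hH₁.1 t ⟨ht.1, htT⟩
    · obtain ⟨k, hk, hkw, -, -, -⟩ := hwindow t ht (not_lt.1 htT)
      obtain ⟨K, -, hK⟩ := (hind k hk).2.2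
      exact (hK t hkw).1.of_le (by norm_num) (by norm_num)
  · -- continuity in `Ḣ^{1/2}`
    by_cases htT : t₀ < T₁
    · rw [nhdsWithin_eq_nhdsWithin_of_mem_of_subset (hnear t₀ ht₀ htT) hsub₁]
      exact hH₁.2 t₀ ⟨ht₀.1, htT⟩
    · obtain ⟨k, hk, hkw, hW, hWS, hIoi⟩ := hwindow t₀ ht₀ (not_lt.1 htT)
      obtain ⟨hc, K, hKtop, hK⟩ := (hind k hk).2
      have ht₀W : t₀ ∈ Ico (sk k) (min (sk k + T_w) T) := ⟨by linarith [hkw.1], hkw.2⟩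
      rw [nhdsWithin_eq_nhdsWithin_of_mem_of_subset hW hWS]
      refine tendsto_eHomSobolevSeminorm_half_of_tendsto_eLpNorm hKtop (hc.2 t₀ ht₀W)
        (eventually_mem_nhdsWithin.mono fun t ht => hc.1 t ht) (hc.1 t₀ ht₀W) ?_ (hK t₀ hkw).2
      filter_upwards [inter_mem_nhdsWithin (Ico (sk k) (min (sk k + T_w) T)) hIoi] with t ht
      exact (hK t ⟨(le_of_lt ht.2), ht.1.2⟩).2

/-- **Discharge of `kato_fujitaKato_persistence`**: the Kato and the Fujita–Kato solutions from
`u₀ ∈ Ḣ^{1/2} ∩ L²` coincide and have the same maximal time (Rusin–Šverák 2011, §1 and §3;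
Gallagher–Koch–Planchon 2016, p. 4) — `kato_fujitaKato_persistence_of_bounded` applied to
`bounded_mild_fujitaKato_persistence_holds`. [cite: RusinSverak2011, §3 (arXiv:0911.0500 p. 5)] -/
theorem kato_fujitaKato_persistence_holds : kato_fujitaKato_persistence :=
  kato_fujitaKato_persistence_of_bounded bounded_mild_fujitaKato_persistence_holds

/-- **ns.S14 — discharge of `rusinSverakRhoMaxPure_le`** (`MildSolutions.lean`): for `ν > 0` the
Rusin–Šverák threshold over the full space `Ḣ^{1/2}` is at most the finite-energy threshold,
`rusinSverakRhoMaxPure ν ≤ rusinSverakRhoMax ν` — an `Ḣ^{1/2} ∩ L²` datum below the pure threshold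
is represented in `Ḣ^{1/2}` by `HomSobolev.ofFun` with the same norm and has a global Kato
solution, which is a global Fujita–Kato solution by the persistence of `Ḣ^{1/2} ∩ L²` regularity
(Lemarié-Rieusset 2016, Thm. 15.2; Rusin–Šverák 2011, §1, §3):
`rusinSverakRhoMaxPure_le_of_bounded bounded_mild_fujitaKato_persistence_holds`.
[cite: LemarieRieusset2016, Thm. 15.2] -/
theorem rusinSverakRhoMaxPure_le_holds : rusinSverakRhoMaxPure_le :=
  rusinSverakRhoMaxPure_le_of_bounded bounded_mild_fujitaKato_persistence_holds

end Core

end Literature.Analysis.FluidPDE
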